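import Summits.ABC.IUTFork.Cor312Ind3IteratesVacuityBoundary
import Literature.IUT.LogVolume.WildCubicUnitLogUnit
import Mathlib.FieldTheory.SplittingField.Construction
import HarnessLib

/-!
# [IUTchIII] Thm 3.11 (ii) (Ind3), honest model: depth `2` IS INHABITED at a wildly ramified place
# (abc-iut cell, wave-5 seat abc-iut-w5-d172, gen 2; record-only, D-0012)

S. Mochizuki, *Inter-universal Teichmüller theory III*, kurims manuscript (May 2020), Prop. 3.5 (ii) (a)(b)
pp. 104–105, Rmk. 1.1.1 (i) p. 28 [claim: Mochizuki2012, status: disputed].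

`Cor312Ind3IteratesVacuity` (p414009, gen 0 of this seat) proved that in abc-iut-w4-d029's honest model of
the log-link iterates (`Cor312Ind3RealIterates`, p412330) the nonarchimedean (Ind3) iterate images of depth
`≥ 2` for the ANALYTIC `p_v`-adic logarithms (`Real.analyticLogv`, abc-iut-c312-5) are EMPTY at every finite
place `v` with `e(v|p_v) ≤ p_v − 1` (`Real.nonarchIterImage_add_two_eq_empty`), and
`Cor312Ind3IteratesVacuityBoundary` (p415013) recorded the binder-level boundary: depth `2` is inhabited iff
some `log_v u` is itself a unit.  This PROOF-ONLY file shows that the boundary is ATTAINED, i.e. that the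
ramification hypothesis of p414009 cannot be dropped:

* `Real.residueChar_eq_of_prime_natCast_mem` — bookkeeping: a finite place containing the prime `p` has
  residue characteristic `p`;
* `Real.norm_of_analyticLogv_eq_one_of_cube` — if `3 ∈ 𝔭_v` and `x ∈ K_v` satisfies `x³ = 3`, then the
  analytic logarithm of the unit `1 + x` is a UNIT of `O_v` (classical: `log₃(1+x) = x − x²/2 + x³/3 − ⋯`
  and the cubic term `x³/3 = 1` dominates — `Literature.IUT.LogVolume.WildCubic.norm_unitLog_one_add_pi_eq_one`,
  Neukirch ANT II (5.5));
* **`Real.nonarchIterImage_analyticLogv_two_nonempty_of_cube`** — hence the honest depth-`2` (Ind3) iterate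
  image `Real.nonarchIterImage (analyticLogv F) v 2` is NONEMPTY at such `v` (via p415013's
  `nonarchIterImage_two_nonempty_of_exists_eq_coe_unit`), and (`Real.not_ramificationIdx_le_of_cube`) the
  hypothesis `e(v|p_v) ≤ p_v − 1` of p414009 FAILS there (so `e(v|3) ≥ 3 = p_v`: wild ramification);
* **`Real.exists_numberField_nonarchIterImage_two_nonempty`** — the instance EXISTS: the splitting field of
  `X³ − 3` over `ℚ` and any of its places over `3`.

Census consequence (numbers, not a side): in the honest model the nonarchimedean (Ind3) clauses of depth
`m′ ≥ 2` are `∅ ⊆ _` exactly away from the finitely many places with `e(v|p_v) ≥ p_v`, and at such places they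
CAN carry content (here: they do, at every place over `3` of any number field containing a cube root of `3`).
Honest framing: statements ABOUT THE MODEL; nothing here asserts or denies [IUTchIII] Cor. 3.12 or takes a
side; typed ≠ proved; instantiated ≠ endorsed.  No definitions, no Prop-valued fact (D-0067 (1)).
-/

noncomputable section

open Set

namespace Summit.ABC.IUTFork.Thm311.Real

open NumberField IsDedekindDomain Literature.IUT.LogVolume Literature.IUT.LogThetaLattice
  Literature.NumberTheory.NumberFields Polynomial

variable {F : Type} [Field F] [NumberField F]

/-! ## 1. Bookkeeping: residue characteristic and units of `O_v` -/

omit [NumberField F] in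
/-- A finite place whose prime contains the rational prime `p` has residue characteristic `p_v = p`
(two distinct rational primes are coprime, so they cannot both lie in the proper ideal `𝔭_v`). [folklore] -/
theorem residueChar_eq_of_prime_natCast_mem (v : HeightOneSpectrum (𝓞 F)) {p : ℕ} (hp : p.Prime)
    (h : ((p : ℕ) : 𝓞 F) ∈ v.asIdeal) : residueChar F v = p := by
  by_contra hne
  have hq := residueChar_prime F v
  have hcop : Nat.Coprime (residueChar F v) p := (Nat.coprime_primes hq hp).mpr hne
  obtain ⟨a, b, hab⟩ := Nat.isCoprime_iff_coprime.mpr hcop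
  have h1 : (1 : 𝓞 F) ∈ v.asIdeal := by
    have hcast : (((a * (residueChar F v : ℕ) + b * (p : ℕ) : ℤ)) : 𝓞 F) = 1 := by
      rw [hab]; push_cast; rfl
    rw [← hcast]
    push_cast
    exact v.asIdeal.add_mem (v.asIdeal.mul_mem_left _ (natCast_residueChar_mem F v))
      (v.asIdeal.mul_mem_left _ h)
  exact v.isPrime.ne_top ((Ideal.eq_top_iff_one _).mpr h1)

/-- An element of `K_v` of rescaled norm `1` (abc-iut-S7's `RescaledCompletion`, same unit ball as `K_v`) is
(the image of) a unit of `O_v`. [folklore] -/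
theorem exists_unit_coe_eq_of_norm_rescaled_eq_one (v : HeightOneSpectrum (𝓞 F)) (p : ℕ)
    (hv : ((p : ℕ) : 𝓞 F) ∈ v.asIdeal) (y : v.adicCompletion F)
    (hy : ‖RescaledCompletion.of F p v hv y‖ = 1) :
    ∃ u : (↥(v.adicCompletionIntegers F))ˣ, ((u : ↥(v.adicCompletionIntegers F)) : v.adicCompletion F) = y := by
  have hy0 : y ≠ 0 := by
    rintro rfl
    rw [map_zero, norm_zero] at hy
    exact zero_ne_one hy
  have hyO : y ∈ v.adicCompletionIntegers F :=
    (mem_integers_iff_norm_rescaled_le_one F p v hv (RescaledCompletion.of F p v hv y)).mpr hy.le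
  have hyinv : ‖RescaledCompletion.of F p v hv y⁻¹‖ = 1 := by
    rw [map_inv₀, norm_inv, hy, inv_one]
  have hyO' : y⁻¹ ∈ v.adicCompletionIntegers F :=
    (mem_integers_iff_norm_rescaled_le_one F p v hv (RescaledCompletion.of F p v hv y⁻¹)).mpr hyinv.le
  exact ⟨⟨⟨y, hyO⟩, ⟨y⁻¹, hyO'⟩, Subtype.ext (mul_inv_cancel₀ hy0), Subtype.ext (inv_mul_cancel₀ hy0)⟩, rfl⟩

/-! ## 2. The local computation: `log₃(1 + x)` is a unit when `x³ = 3` -/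

/-- In the rescaled completion at a place over `p = 3`: if `x³ = 3` then `1 + x` has norm `1` and its
`3`-adic logarithm (abc-iut-S1's `unitLog`) has norm `1` — `Literature.IUT.LogVolume.WildCubic.
norm_unitLog_one_add_pi_eq_one` (the cubic term `x³/3 = 1` of the logarithmic series is a unit).
Stated for a prime `p` with `p = 3` so that it applies verbatim to the `p_v` of `Real.analyticLogv_apply`.
[cite: NeukirchANT1999, Ch. II (5.5)] -/
theorem norm_rescaled_one_add_and_unitLog_eq_one (v : HeightOneSpectrum (𝓞 F)) (p : ℕ) [Fact p.Prime]
    (hv : ((p : ℕ) : 𝓞 F) ∈ v.asIdeal) (hp3 : p = 3) (x : v.adicCompletion F) (hx : x ^ 3 = 3) :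
    ‖RescaledCompletion.of F p v hv (1 + x)‖ = 1 ∧
      ‖unitLog (RescaledCompletion.of F p v hv (1 + x))‖ = 1 := by
  subst hp3
  have hπ : (RescaledCompletion.of F 3 v hv x) ^ 3 = 3 := by
    rw [← map_pow, hx, map_ofNat]
  rw [map_add, map_one]
  exact ⟨WildCubic.norm_one_add_pi hπ, WildCubic.norm_unitLog_one_add_pi_eq_one hπ⟩

/-- **The analytic logarithm of the unit `1 + x`, `x³ = 3`, is a unit of `O_v`** (rescaled norm `1`), at a
finite place `v` over `3`. [cite: NeukirchANT1999, Ch. II (5.5)] -/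
theorem norm_of_analyticLogv_eq_one_of_cube (v : HeightOneSpectrum (𝓞 F))
    (h3 : ((3 : ℕ) : 𝓞 F) ∈ v.asIdeal) (x : v.adicCompletion F) (hx : x ^ 3 = 3)
    (w : (↥(v.adicCompletionIntegers F))ˣ)
    (hw : ((w : ↥(v.adicCompletionIntegers F)) : v.adicCompletion F) = 1 + x) :
    ‖RescaledCompletion.of F (residueChar F v) v (natCast_residueChar_mem F v)
        (analyticLogv F v (Additive.ofMul w))‖ = 1 := by
  haveI : Fact (residueChar F v).Prime := ⟨residueChar_prime F v⟩
  rw [analyticLogv_apply, RingEquiv.apply_symm_apply, hw]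
  exact (norm_rescaled_one_add_and_unitLog_eq_one v (residueChar F v) (natCast_residueChar_mem F v)
    (residueChar_eq_of_prime_natCast_mem v Nat.prime_three h3) x hx).2

/-! ## 3. Depth `2` is inhabited; the ramification hypothesis of p414009 fails -/

/-- **At a finite place `v` over `3` whose completion contains a cube root `x` of `3`, the honest depth-`2`
nonarchimedean (Ind3) iterate image for the ANALYTIC logarithms is NONEMPTY**: `1 + x ∈ O_v^×` has
`log_v(1 + x) ∈ O_v^×`, so `log_v(log_v(1+x))` is a depth-`2` element (p415013's
`nonarchIterImage_two_nonempty_of_exists_eq_coe_unit`). [claim: Mochizuki2012, status: disputed] -/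
theorem nonarchIterImage_analyticLogv_two_nonempty_of_cube (v : HeightOneSpectrum (𝓞 F))
    (h3 : ((3 : ℕ) : 𝓞 F) ∈ v.asIdeal) (x : v.adicCompletion F) (hx : x ^ 3 = 3) :
    (nonarchIterImage (analyticLogv F) v 2).Nonempty := by
  haveI : Fact (residueChar F v).Prime := ⟨residueChar_prime F v⟩
  have hp : residueChar F v = 3 := residueChar_eq_of_prime_natCast_mem v Nat.prime_three h3
  have hn1 := (norm_rescaled_one_add_and_unitLog_eq_one v (residueChar F v)
    (natCast_residueChar_mem F v) hp x hx).1
  obtain ⟨w, hw⟩ := exists_unit_coe_eq_of_norm_rescaled_eq_one v (residueChar F v)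
    (natCast_residueChar_mem F v) (1 + x) hn1
  obtain ⟨u, hu⟩ := exists_unit_coe_eq_of_norm_rescaled_eq_one v (residueChar F v)
    (natCast_residueChar_mem F v) (analyticLogv F v (Additive.ofMul w))
    (norm_of_analyticLogv_eq_one_of_cube v h3 x hx w hw)
  exact nonarchIterImage_two_nonempty_of_exists_eq_coe_unit (analyticLogv F) v ⟨w, u, hu.symm⟩

/-- … so the per-place honest family `Real.iterImage (analyticLogv F) 2` is nonempty at `v`.
[claim: Mochizuki2012, status: disputed] -/
theorem iterImage_analyticLogv_two_inr_nonempty_of_cube (v : HeightOneSpectrum (𝓞 F))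
    (h3 : ((3 : ℕ) : 𝓞 F) ∈ v.asIdeal) (x : v.adicCompletion F) (hx : x ^ 3 = 3) :
    (iterImage (analyticLogv F) 2 (.inr v : Place F)).Nonempty :=
  nonarchIterImage_analyticLogv_two_nonempty_of_cube v h3 x hx

/-- **The hypothesis `e(v|p_v) ≤ p_v − 1` of p414009's `Real.nonarchIterImage_add_two_eq_empty` CANNOT BE
DROPPED**: at a place over `3` with a cube root of `3` in its completion it fails (the depth-`2` image is
nonempty there, while p414009 makes it empty under the hypothesis).  [claim: Mochizuki2012, status: disputed] -/
theorem not_ramificationIdx_le_of_cube (v : HeightOneSpectrum (𝓞 F))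
    (h3 : ((3 : ℕ) : 𝓞 F) ∈ v.asIdeal) (x : v.adicCompletion F) (hx : x ^ 3 = 3) :
    ¬ v.asIdeal.ramificationIdx ℤ ≤ residueChar F v - 1 := by
  intro he
  have h := nonarchIterImage_analyticLogv_two_nonempty_of_cube v h3 x hx
  rw [nonarchIterImage_add_two_eq_empty v he 0] at h
  exact Set.not_nonempty_empty h

/-- Equivalently: such a place is WILDLY ramified, `p_v = 3 ≤ e(v|3)`. [folklore] -/
theorem residueChar_le_ramificationIdx_of_cube (v : HeightOneSpectrum (𝓞 F))
    (h3 : ((3 : ℕ) : 𝓞 F) ∈ v.asIdeal) (x : v.adicCompletion F) (hx : x ^ 3 = 3) :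
    residueChar F v ≤ v.asIdeal.ramificationIdx ℤ := by
  have h := not_ramificationIdx_le_of_cube v h3 x hx
  omega

/-! ## 4. The instance exists: the splitting field of `X³ − 3` -/

/-- A cube root of `3` in `F` gives one in every completion `K_v`. [folklore] -/
theorem exists_cube_eq_three_adicCompletion {α : F} (hα : α ^ 3 = 3)
    (v : HeightOneSpectrum (𝓞 F)) : ∃ x : v.adicCompletion F, x ^ 3 = 3 :=
  ⟨algebraMap F (v.adicCompletion F) α, by rw [← map_pow, hα, map_ofNat]⟩

/-- Over every rational prime `p` lies a finite place of `F` (the ideal `(p)` of `𝓞 F` has absolute norm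
`p^[F:ℚ] ≠ 1`, so it is proper; abc-iut-L5-t2's private `exists_heightOneSpectrum_natCast_mem` of
`InitialThetaDataPlaces`, re-proved here since it is private there). [folklore] -/
theorem exists_heightOneSpectrum_natCast_mem' {p : ℕ} (hp : p.Prime) :
    ∃ P : HeightOneSpectrum (𝓞 F), (p : 𝓞 F) ∈ P.asIdeal := by
  have hne : Ideal.span {(p : 𝓞 F)} ≠ ⊤ := by
    intro htop
    have h1 := (Ideal.absNorm_eq_one_iff (I := Ideal.span {(p : 𝓞 F)})).mpr htop
    rw [Ideal.absNorm_span_natCast, RingOfIntegers.rank] at h1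
    have hpos : 0 < Module.finrank ℚ F := Module.finrank_pos
    have : p ^ Module.finrank ℚ F ≠ 1 := by
      have h2 : 2 ≤ p := hp.two_le
      have : p ≤ p ^ Module.finrank ℚ F := Nat.le_self_pow hpos.ne' p
      omega
    exact this h1
  obtain ⟨Q, hQmax, hle⟩ := Ideal.exists_le_maximal _ hne
  have hp0 : (p : 𝓞 F) ≠ 0 := by exact_mod_cast hp.ne_zero
  have hpQ : (p : 𝓞 F) ∈ Q := hle (Ideal.subset_span rfl)
  refine ⟨⟨Q, hQmax.isPrime, ?_⟩, hpQ⟩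
  intro hQ
  rw [hQ, Ideal.mem_bot] at hpQ
  exact hp0 hpQ

/-- **A number field with a cube root of `3`**: the splitting field of `X³ − 3 ∈ ℚ[X]`. [folklore] -/
theorem exists_numberField_cube_eq_three :
    ∃ (F : Type) (_ : Field F) (_ : NumberField F) (α : F), α ^ 3 = 3 := by
  obtain ⟨K, _, _, hK, hfd⟩ : ∃ (K : Type) (_ : Field K) (_ : Algebra ℚ K),
      Splits ((X ^ 3 - C (3 : ℚ)).map (algebraMap ℚ K)) ∧ FiniteDimensional ℚ K :=
    ⟨(X ^ 3 - C (3 : ℚ)).SplittingField, inferInstance, inferInstance, SplittingField.splits _,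
      inferInstance⟩
  haveI : CharZero K := charZero_of_injective_algebraMap (algebraMap ℚ K).injective
  haveI : Module.Finite ℚ K := hfd
  haveI : NumberField K := NumberField.of_module_finite ℚ K
  have hdeg : ((X ^ 3 - C (3 : ℚ)).map (algebraMap ℚ K)).degree ≠ 0 := by
    rw [Polynomial.degree_map, degree_X_pow_sub_C (by norm_num)]
    decide
  obtain ⟨α, hα⟩ := hK.exists_eval_eq_zero hdeg
  refine ⟨K, inferInstance, inferInstance, α, ?_⟩
  rw [eval_map, eval₂_sub, eval₂_X_pow, eval₂_C, map_ofNat (algebraMap ℚ K) 3, sub_eq_zero] at hα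
  exact hα

/-- **EXISTENCE OF A WILD PLACE WITH INHABITED DEPTH `2`**: there are a number field `F` (the splitting field
of `X³ − 3`) and a finite place `v` of residue characteristic `3` at which the honest depth-`2` (Ind3) iterate
image for the analytic logarithms is NONEMPTY and the hypothesis `e(v|p_v) ≤ p_v − 1` of p414009 fails.
The vacuous range recorded in `Cor312Ind3IteratesVacuity(Boundary)` is therefore EXACT on the nonarchimedean
side as well. [claim: Mochizuki2012, status: disputed] -/
theorem exists_numberField_nonarchIterImage_two_nonempty :
    ∃ (F : Type) (_ : Field F) (_ : NumberField F) (v : HeightOneSpectrum (𝓞 F)),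
      residueChar F v = 3 ∧ (nonarchIterImage (analyticLogv F) v 2).Nonempty ∧
        ¬ v.asIdeal.ramificationIdx ℤ ≤ residueChar F v - 1 := by
  obtain ⟨F, _, _, α, hα⟩ := exists_numberField_cube_eq_three
  obtain ⟨v, hv⟩ := exists_heightOneSpectrum_natCast_mem' (F := F) Nat.prime_three
  obtain ⟨x, hx⟩ := exists_cube_eq_three_adicCompletion hα v
  exact ⟨F, inferInstance, inferInstance, v, residueChar_eq_of_prime_natCast_mem v Nat.prime_three hv,
    nonarchIterImage_analyticLogv_two_nonempty_of_cube v hv x hx, not_ramificationIdx_le_of_cube v hv x hx⟩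

/-- In EVERY number field containing a cube root of `3`, EVERY place over `3` has inhabited depth-`2` image
and violates `e(v|p_v) ≤ p_v − 1`. [claim: Mochizuki2012, status: disputed] -/
theorem nonarchIterImage_analyticLogv_two_nonempty_of_cube_mem {α : F} (hα : α ^ 3 = 3)
    (v : HeightOneSpectrum (𝓞 F)) (h3 : ((3 : ℕ) : 𝓞 F) ∈ v.asIdeal) :
    (nonarchIterImage (analyticLogv F) v 2).Nonempty ∧ ¬ v.asIdeal.ramificationIdx ℤ ≤ residueChar F v - 1 := by
  obtain ⟨x, hx⟩ := exists_cube_eq_three_adicCompletion hα v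
  exact ⟨nonarchIterImage_analyticLogv_two_nonempty_of_cube v h3 x hx, not_ramificationIdx_le_of_cube v h3 x hx⟩


/-! ## 5. Packet and column level: an honest (Ind3) unit-image clause of depth `2` that is NOT vacuous -/

/-- A pure-tensor image `tprodImages` is NONEMPTY as soon as every component set is (choose one element per
place of the fibre and tensor the constant family). [folklore] -/
theorem _root_.Summit.ABC.IUTFork.Thm311.LogShells.tprodImages_nonempty_of_forall_nonempty
    {T : ThetaIndex} (L : LogShells T) (j : T.Label) (vQ : T.VQ)
    (S : ∀ v : T.Fibre vQ, Set (L.carrier v.1)) (h : ∀ v, (S v).Nonempty) :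
    (L.tprodImages j vQ S).Nonempty := by
  choose x hx using h
  exact ⟨L.tprod j vQ (fun _ => x), fun _ => x, fun _ v => hx v, rfl⟩

/-- A place of the fibre over the prime `3` is a finite place `w` with `3 ∈ 𝔭_w`. [folklore] -/
theorem three_mem_of_over_eq (X : PilotData F) {x : Place F}
    (hx : (thetaIndex X).over x = (.inr ⟨3, Nat.prime_three⟩ : RatPlace)) :
    ∃ w : HeightOneSpectrum (𝓞 F), x = .inr w ∧ ((3 : ℕ) : 𝓞 F) ∈ w.asIdeal := by
  rcases x with w | w
  · exact absurd hx (by simp [thetaIndex])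
  · refine ⟨w, rfl, ?_⟩
    have h3 : residueChar F w = 3 := by
      have h := hx
      simp only [thetaIndex, Place.under_inr, Sum.inr.injEq] at h
      exact congrArg Subtype.val h
    rw [← h3]
    exact natCast_residueChar_mem F w

/-- **If `F` contains a cube root of `3`, every honest component of depth `2` over `v_ℚ = 3` is NONEMPTY**
(every place of the fibre is wild with `log_w(1 + ∛3)` a unit). [claim: Mochizuki2012, status: disputed] -/
theorem honestU_two_nonempty_of_cube_mem (X : PilotData F) {α : F} (hα : α ^ 3 = 3) (m : ℤ)
    (v : (thetaIndex X).Fibre (.inr ⟨3, Nat.prime_three⟩ : RatPlace)) :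
    (honestU X (analyticLogv F) m 2 (.inr ⟨3, Nat.prime_three⟩) v).Nonempty := by
  obtain ⟨x, hx⟩ := v
  obtain ⟨w, rfl, h3⟩ := three_mem_of_over_eq X hx
  exact (nonarchIterImage_analyticLogv_two_nonempty_of_cube_mem hα w h3).1

/-- **The pure-tensor unit image of the honest depth-`2` components over `v_ℚ = 3` is NONEMPTY** when `F`
contains a cube root of `3` — contrast with p414009's `tprodImages_honestU_add_two_eq_empty` (empty as soon as
ONE place of the fibre has `e ≤ p − 1`). [claim: Mochizuki2012, status: disputed] -/
theorem tprodImages_honestU_two_nonempty_of_cube_mem (X : PilotData F) {α : F} (hα : α ^ 3 = 3) (m : ℤ)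
    (j : (thetaIndex X).Label) :
    ((logShellsDH X (analyticLogv F)).tprodImages j (.inr ⟨3, Nat.prime_three⟩ : RatPlace)
      (honestU X (analyticLogv F) m 2 (.inr ⟨3, Nat.prime_three⟩))).Nonempty :=
  LogShells.tprodImages_nonempty_of_forall_nonempty _ j _ _ (honestU_two_nonempty_of_cube_mem X hα m)

/-- **NON-VACUITY OF A DEPTH-`2` (Ind3) CLAUSE IN THE HONEST MODEL.** For pilot data `X` over a number field
`F` containing a cube root of `3`, and ANY column over the Dupuy–Hilado instance `Real.logShellsDH X
(analyticLogv F)` with honest unit images (abc-iut-w4-d029's hypothesis `hunit`), the unit image at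
`(m, m′ = 2, j, v_ℚ = 3)` is NONEMPTY — so the (Ind3) containment `unitImage ⊆ shellPk` there is NOT of the
form `∅ ⊆ _`: the exact complement of p414009's `Column.unitImage_add_two_eq_empty_of_honestImages`.
[claim: Mochizuki2012, status: disputed] -/
theorem _root_.Summit.ABC.IUTFork.Thm311.Column.unitImage_two_nonempty_of_honestImages_of_cube_mem
    (X : PilotData F) {α : F} (hα : α ^ 3 = 3) (C : Column (logShellsDH X (analyticLogv F)))
    (hunit : ∀ (m : ℤ) (m' : ℕ) (j : (thetaIndex X).Label) (vQ : (thetaIndex X).VQ),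
      C.unitImage m m' j vQ =
        (logShellsDH X (analyticLogv F)).tprodImages j vQ (honestU X (analyticLogv F) m m' vQ))
    (m : ℤ) (j : (thetaIndex X).Label) :
    (C.unitImage m 2 j (.inr ⟨3, Nat.prime_three⟩ : RatPlace)).Nonempty := by
  rw [hunit]
  exact tprodImages_honestU_two_nonempty_of_cube_mem X hα m j

end Summit.ABC.IUTFork.Thm311.Real

end
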